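import Summits.QuantumFields.YangMills.Theorems.BalabanUVNodesN19LawPrice

/-!
# YM-DAG node N19 (= NE7 proper) — THE LAW-LEVEL PRICE IS LOGARITHMIC, V: the typed lower RATE `log(e+L)∕(1+L)`

Cell `pub-ymgap`, HUMAN RULING D-0062 (Track A), R141 (C) wider-strategy seat `pub-ymgap-dag-n19-e` (strategy s3 = ALTERNATIVE CURRENCY), generation
g18, module 1.  Route `Summits/QuantumFields/YangMills/Theses/BalabanUVNodes.lean` rev 25, cluster item K3⁷ «SpineGivenEndpointR13SepCoPH»
(stmt-QuantumFields-20544, dag-lead WORDS-143); filed `--supports` that item `--as helper` (it proves no registered stub).  COUNT-NEUTRAL: elementary real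
analysis over Mathlib (`Real.log_le_sub_one_of_pos`, `Real.add_pow_le_pow_mul_pow_of_sq_le_sq`, `Real.pi_le_four`) + the seat's p543481 `…N19LawPrice`
BY NAME (`exists_cgf_close_laws_far`, `lipschitzWith_one_cosWave`, `cosWave_nonneg`, `cosWave_le`); no scheme object, no Theses import; NOT a discharge claim.

THE POINT (answers referee ref-K READ-92 NIT N1 on p543481 BY CONTENT).  p543481's header prose says the law-level price of window matching is
`≳ log L∕L`, `L = log⁺ε⁻¹`, while its typed §4 `law_price_not_inverse_log` only refutes `C∕(1+L)` for every `C` — the rate needs the untyped step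
`L ≍ n log n` from §3's two-sided bounds `2(l₀∕2n)ⁿ ≤ ε ≤ 2(l₀e^{l₀}∕2n)ⁿ` on the binomial witness.  This module types that step: at level `n ≥ n₀(l₀)`
the cgf-closeness parameter `ε′ = e^{l₀}ε` of the §3 pair satisfies `(l₀∕(2n))ⁿ ≤ ε′ ≤ (√n)^{−n}`, so `L′ = log⁺ε′⁻¹ ∈ [(n∕2)·log n, n·log(2n∕l₀)]`,
`log(e+L′) ≤ 3 log n` (§1), and the payment `2∕(πn)` of the `1`-Lipschitz `[0,1]`-valued test function `g_n` dominates `log(e+L′)∕(12(1+L′))` (§2).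
★★ `law_price_ge_logRate` (§3, `ε`-language): for every window `0 < l₀` and every `ε₀ > 0` two probability laws on `[0,1]` with cgf's `ε`-close on
`|t| ≤ l₀`, `0 < ε ≤ ε₀`, and a `1`-Lipschitz `g : ℝ → [0,1]` with `|∫ g dν − ∫ g dμ| ≥ log(e+L)∕(12(1+L))` — a UNIVERSAL constant `1∕12` (the
`l₀`-dependence is absorbed in how small `ε` must be).  With the Jackson-road upper bound `C(l₀)·log(e+L)∕(1+L)` of the siblings to follow
(`…N19LawPriceJackson`, `…N19LawPriceTwoSided`), `log(e+L)∕(1+L)` IS the law-level price, two-sided up to an `l₀`-constant — the law analogue of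
p517472's `sharp_price_two_sided` (`P(ε) = ε(1+L)∕log(e+L)` for expectations).

HONEST FRAMING (binding).  Elementary and [folklore]; NO consumer in the DAG today; an optimality statement about the seat's own currency.  Nothing of
Bałaban's is instantiated; NE7 ∕ NE7b ∕ NE7c NOT PRINTED, NOT proved; N19 NOT discharged; count-neutral.  One finite `T⁴` programme at fixed `ε`;
nothing continuum ∕ `ℝ⁴` ∕ OS ∕ mass-gap ∕ Clay.  0 `def` ∕ 0 `sorry`.
-/

noncomputable section

open Real Finset MeasureTheory ProbabilityTheory

namespace Summit.QuantumFields.YangMills.Theorems.BalabanUVNodesN19LawPriceLowerRate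

open Summit.QuantumFields.YangMills.Theorems.BalabanUVNodesN19LawPrice
  (exists_cgf_close_laws_far lipschitzWith_one_cosWave cosWave_nonneg cosWave_le)

/-! ## §1 The rate function `log(e+L)∕(1+L)` on the window `(n∕2)log n ≤ L`, `e + L ≤ n³` [folklore] -/

/-- If `2 ≤ n`, `(n∕2)·log n ≤ L` and `e + L ≤ n³` then `log(e+L)∕(1+L) ≤ 6∕n`. [folklore] -/
theorem logRate_le_six_div {n L : ℝ} (hn : 2 ≤ n) (hL : n / 2 * Real.log n ≤ L) (hL3 : Real.exp 1 + L ≤ n ^ 3) :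
    Real.log (Real.exp 1 + L) / (1 + L) ≤ 6 / n := by
  have hn0 : 0 < n := by linarith
  have hlog : 0 < Real.log n := Real.log_pos (by linarith)
  have hL0 : 0 < n / 2 * Real.log n := by positivity
  have hpos : 0 < Real.exp 1 + L := by have := Real.exp_pos 1; linarith
  have h3 : Real.log (n ^ 3) = 3 * Real.log n := by
    rw [Real.log_pow]; norm_num
  have h1 : Real.log (Real.exp 1 + L) ≤ 3 * Real.log n := by
    rw [← h3]
    exact Real.log_le_log hpos hL3
  have h2 : n / 2 * Real.log n ≤ 1 + L := by linarith
  calc Real.log (Real.exp 1 + L) / (1 + L) ≤ 3 * Real.log n / (n / 2 * Real.log n) :=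
        div_le_div₀ (by positivity) h1 hL0 h2
    _ = 6 / n := by field_simp; ring

/-! ## §2 The binomial witness at level `n`: `(l₀∕(2n))ⁿ ≤ ε′ ≤ (√n)^{−n}` and the payment dominates the rate -/

/-- **THE WITNESS AT LEVEL `n`, WITH ITS RATE.**  For `0 < l₀` and `n` past the explicit thresholds `2`, `(l₀e^{l₀})²`, `2e^{l₀}`, `4∕l₀`, `l₀∕2`:
p543481's pair of probability laws `μ, ν` on `[0,1]` at level `n` has cgf's `ε′`-close on `|t| ≤ l₀` with `0 < ε′ ≤ (√n)^{−n}` (so `ε′ ≤ 1∕n`),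
`(n∕2)·log n ≤ log⁺ε′⁻¹ ≤ n·log(2n∕l₀)`, and the `1`-Lipschitz `[0,1]`-valued test function `g_n(x) = (1 − cos(πnx))∕(πn)` is paid
`|∫ g_n dν − ∫ g_n dμ| = 2∕(πn) ≥ log(e + log⁺ε′⁻¹)∕(12·(1 + log⁺ε′⁻¹))`. [folklore] -/
theorem exists_cgf_close_laws_far_rate {l₀ : ℝ} (hl₀ : 0 < l₀) {n : ℕ} (hn2 : 2 ≤ n)
    (hna : (l₀ * Real.exp l₀) ^ 2 ≤ n) (hne : 2 * Real.exp l₀ ≤ n) (hnl : 4 / l₀ ≤ n) (hln : l₀ ≤ 2 * n) :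
    ∃ μ ν : Measure ℝ, IsProbabilityMeasure μ ∧ IsProbabilityMeasure ν ∧
      μ (Set.Icc 0 1)ᶜ = 0 ∧ ν (Set.Icc 0 1)ᶜ = 0 ∧
      ∃ ε : ℝ, 0 < ε ∧ ε ≤ ((Real.sqrt n) ^ n)⁻¹ ∧ ε ≤ 1 / n ∧
        (∀ t : ℝ, |t| ≤ l₀ → |cgf id ν t - cgf id μ t| ≤ ε) ∧
        (n : ℝ) / 2 * Real.log n ≤ Real.posLog ε⁻¹ ∧ Real.posLog ε⁻¹ ≤ n * Real.log (2 * n / l₀) ∧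
        |∫ x, (1 - cos (π * n * x)) / (π * n) ∂ν - ∫ x, (1 - cos (π * n * x)) / (π * n) ∂μ| = 2 / (π * n) ∧
        Real.log (Real.exp 1 + Real.posLog ε⁻¹) / (12 * (1 + Real.posLog ε⁻¹)) ≤
          |∫ x, (1 - cos (π * n * x)) / (π * n) ∂ν - ∫ x, (1 - cos (π * n * x)) / (π * n) ∂μ| := by
  have hnr2 : (2 : ℝ) ≤ n := by exact_mod_cast hn2
  have hnr : (0 : ℝ) < n := by linarith
  have hn0 : 0 < n := by exact_mod_cast hnr
  have hn1 : (1 : ℝ) ≤ n := by linarith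
  obtain ⟨μ, ν, iμ, iν, hμ, hν, ε, hε, hlo, hhi, -, -, hcgf, -, htest⟩ := exists_cgf_close_laws_far hl₀ hn0
  set ε' : ℝ := Real.exp l₀ * ε with hε'
  have hε'0 : 0 < ε' := by positivity
  -- the square root of `n`
  have hsq0 : 0 < Real.sqrt n := Real.sqrt_pos.2 hnr
  have hsq1 : 1 ≤ Real.sqrt n := by rw [← Real.sqrt_one]; exact Real.sqrt_le_sqrt hn1
  have hsqn : Real.sqrt n * Real.sqrt n = n := Real.mul_self_sqrt hnr.le
  -- UPPER: `ε' ≤ (√n)^{-n}`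
  set a : ℝ := l₀ * Real.exp l₀ / 2 with ha
  have ha0 : 0 < a := by positivity
  have h2a : 2 * a ≤ Real.sqrt n := by
    have h4 : (2 * a) ^ 2 ≤ n := by rw [ha]; convert hna using 1; ring
    calc 2 * a = Real.sqrt ((2 * a) ^ 2) := by rw [Real.sqrt_sq (by positivity)]
      _ ≤ Real.sqrt n := Real.sqrt_le_sqrt h4
  have han : a / n ≤ 1 / (2 * Real.sqrt n) := by
    rw [div_le_div_iff₀ hnr (by positivity), one_mul]
    calc a * (2 * Real.sqrt n) = (2 * a) * Real.sqrt n := by ring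
      _ ≤ Real.sqrt n * Real.sqrt n := mul_le_mul_of_nonneg_right h2a hsq0.le
      _ = n := hsqn
  have hpow2 : (n : ℝ) ≤ 2 ^ n := by exact_mod_cast Nat.lt_two_pow_self.le
  have hup : ε' ≤ ((Real.sqrt n) ^ n)⁻¹ := by
    have h1 : ε ≤ 2 * (a / n) ^ n := by
      rw [ha, show l₀ * Real.exp l₀ / 2 / (n : ℝ) = l₀ * Real.exp l₀ / (2 * n) by rw [div_div]]
      exact hhi
    have h2 : (a / n) ^ n ≤ (1 / (2 * Real.sqrt n)) ^ n := pow_le_pow_left₀ (by positivity) han n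
    have h3 : (1 / (2 * Real.sqrt n)) ^ n = (2 ^ n)⁻¹ * ((Real.sqrt n) ^ n)⁻¹ := by
      rw [div_pow, one_pow, mul_pow, one_div, mul_inv]
    calc ε' ≤ Real.exp l₀ * (2 * (1 / (2 * Real.sqrt n)) ^ n) := by
          rw [hε']; exact mul_le_mul_of_nonneg_left (h1.trans (by gcongr)) (Real.exp_pos _).le
      _ = (2 * Real.exp l₀ / 2 ^ n) * ((Real.sqrt n) ^ n)⁻¹ := by rw [h3]; ring
      _ ≤ 1 * ((Real.sqrt n) ^ n)⁻¹ := by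
          refine mul_le_mul_of_nonneg_right ?_ (by positivity)
          rw [div_le_one (by positivity)]
          exact hne.trans hpow2
      _ = ((Real.sqrt n) ^ n)⁻¹ := one_mul _
  have hup1 : ε' ≤ 1 / n := by
    refine hup.trans ?_
    rw [one_div, inv_le_inv₀ (by positivity) hnr]
    calc (n : ℝ) = Real.sqrt n * Real.sqrt n := hsqn.symm
      _ = (Real.sqrt n) ^ 2 := (sq _).symm
      _ ≤ (Real.sqrt n) ^ n := pow_le_pow_right₀ hsq1 hn2
  -- `L' ≥ (n/2) log n`
  have hLlo : (n : ℝ) / 2 * Real.log n ≤ Real.posLog ε'⁻¹ := by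
    have h1 : (Real.sqrt n) ^ n ≤ ε'⁻¹ := by
      rw [le_inv_comm₀ (by positivity) hε'0]
      exact hup
    have h2 : Real.log ((Real.sqrt n) ^ n) = n / 2 * Real.log n := by
      rw [Real.log_pow, Real.log_sqrt hnr.le]; ring
    calc (n : ℝ) / 2 * Real.log n = Real.log ((Real.sqrt n) ^ n) := h2.symm
      _ ≤ Real.log ε'⁻¹ := Real.log_le_log (by positivity) h1
      _ ≤ Real.posLog ε'⁻¹ := le_max_right 0 (Real.log ε'⁻¹)
  -- LOWER: `ε' ≥ (l₀/(2n))^n`, so `L' ≤ n log(2n/l₀)`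
  have hq1 : 1 ≤ 2 * n / l₀ := by rw [le_div_iff₀ hl₀, one_mul]; exact hln
  have hLhi : Real.posLog ε'⁻¹ ≤ n * Real.log (2 * n / l₀) := by
    have h1 : (l₀ / (2 * n)) ^ n ≤ ε' := by
      calc (l₀ / (2 * n)) ^ n = 1 * (l₀ / (2 * n)) ^ n := (one_mul _).symm
        _ ≤ (Real.exp l₀ * 2) * (l₀ / (2 * n)) ^ n := by
            refine mul_le_mul_of_nonneg_right ?_ (by positivity)
            have := Real.add_one_le_exp l₀  -- `1 + l₀ ≤ e^{l₀}`
            linarith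
        _ = Real.exp l₀ * (2 * (l₀ / (2 * n)) ^ n) := by ring
        _ ≤ ε' := by rw [hε']; exact mul_le_mul_of_nonneg_left hlo (Real.exp_pos _).le
    have h2 : ε'⁻¹ ≤ (2 * n / l₀) ^ n := by
      rw [inv_le_comm₀ hε'0 (by positivity), ← inv_pow, inv_div]
      exact h1
    have h3 : Real.log ε'⁻¹ ≤ n * Real.log (2 * n / l₀) := by
      rw [← Real.log_pow]
      exact Real.log_le_log (by positivity) h2
    have h4 : 0 ≤ (n : ℝ) * Real.log (2 * n / l₀) := mul_nonneg hnr.le (Real.log_nonneg hq1)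
    exact max_le h4 h3
  -- `e + L' ≤ n^3`
  have hL3 : Real.exp 1 + Real.posLog ε'⁻¹ ≤ (n : ℝ) ^ 3 := by
    have he : Real.exp 1 ≤ (n : ℝ) ^ 3 / 2 := by
      have h8 : (8 : ℝ) ≤ (n : ℝ) ^ 3 := by
        have := pow_le_pow_left₀ (by norm_num) hnr2 3
        norm_num at this
        exact this
      have := Real.exp_one_lt_d9
      linarith
    have hlog : Real.log (2 * n / l₀) ≤ 2 * n / l₀ := by
      have := Real.log_le_sub_one_of_pos (by positivity : (0 : ℝ) < 2 * n / l₀); linarith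
    have hL : Real.posLog ε'⁻¹ ≤ (n : ℝ) ^ 3 / 2 := by
      calc Real.posLog ε'⁻¹ ≤ n * Real.log (2 * n / l₀) := hLhi
        _ ≤ n * (2 * n / l₀) := mul_le_mul_of_nonneg_left hlog hnr.le
        _ = (4 / l₀) * ((n : ℝ) ^ 2 / 2) := by ring
        _ ≤ n * ((n : ℝ) ^ 2 / 2) := mul_le_mul_of_nonneg_right hnl (by positivity)
        _ = (n : ℝ) ^ 3 / 2 := by ring
    linarith
  -- the rate is dominated by the payment
  have hrate : Real.log (Real.exp 1 + Real.posLog ε'⁻¹) / (12 * (1 + Real.posLog ε'⁻¹)) ≤ 2 / (π * n) := by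
    have h6 := logRate_le_six_div hnr2 hLlo hL3
    have hL0 : 0 ≤ Real.posLog ε'⁻¹ := Real.posLog_nonneg
    calc Real.log (Real.exp 1 + Real.posLog ε'⁻¹) / (12 * (1 + Real.posLog ε'⁻¹))
        = (Real.log (Real.exp 1 + Real.posLog ε'⁻¹) / (1 + Real.posLog ε'⁻¹)) / 12 := by
          rw [div_div, mul_comm]
      _ ≤ (6 / n) / 12 := div_le_div_of_nonneg_right h6 (by norm_num)
      _ = 2 / (4 * n) := by field_simp; ring
      _ ≤ 2 / (π * n) := by
          refine div_le_div_of_nonneg_left (by norm_num) (by positivity) ?_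
          exact mul_le_mul_of_nonneg_right Real.pi_le_four hnr.le
  refine ⟨μ, ν, iμ, iν, hμ, hν, ε', hε'0, hup, hup1, hcgf, hLlo, hLhi, htest, ?_⟩
  rw [htest]
  exact hrate

/-! ## §3 In `ε`-language: the law-level price is at least `log(e+L)∕(12(1+L))` -/

/-- **★★ THE LAW-LEVEL PRICE IS AT LEAST `log(e+L)∕(12(1+L))` (typed lower RATE; universal constant).**  For every window `0 < l₀` and every
`ε₀ > 0`: two probability laws `μ, ν` on `[0,1]` and `0 < ε ≤ ε₀` with cgf's `ε`-close on `|t| ≤ l₀`, together with a `1`-Lipschitz test function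
`g : ℝ → [0,1]` paid `|∫ g dν − ∫ g dμ| ≥ log(e + L)∕(12·(1 + L))`, `L = log⁺ε⁻¹` (p543481's binomial witness at a level `n ≍ L∕log L`, §2).  So no
estimate `dist_BL(μ,ν) ≤ o(log(e+L)∕(1+L))` follows from window matching of cgf's on the class of `[0,1]`-valued observables: the Jackson-road upper
bound `C(l₀)·log(e+L)∕(1+L)` of the siblings is sharp in order.  Sharpens p543481 §4 `law_price_not_inverse_log` (there: `> C∕(1+L)` for every `C`).
[folklore] -/
theorem law_price_ge_logRate {l₀ : ℝ} (hl₀ : 0 < l₀) {ε₀ : ℝ} (hε₀ : 0 < ε₀) :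
    ∃ μ ν : Measure ℝ, IsProbabilityMeasure μ ∧ IsProbabilityMeasure ν ∧
      μ (Set.Icc 0 1)ᶜ = 0 ∧ ν (Set.Icc 0 1)ᶜ = 0 ∧
      ∃ ε : ℝ, 0 < ε ∧ ε ≤ ε₀ ∧ (∀ t : ℝ, |t| ≤ l₀ → |cgf id ν t - cgf id μ t| ≤ ε) ∧
        ∃ g : ℝ → ℝ, LipschitzWith 1 g ∧ (∀ x, 0 ≤ g x ∧ g x ≤ 1) ∧
          Real.log (Real.exp 1 + Real.posLog ε⁻¹) / (12 * (1 + Real.posLog ε⁻¹)) ≤ |∫ x, g x ∂ν - ∫ x, g x ∂μ| := by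
  obtain ⟨n, hn⟩ := exists_nat_gt
    (max (max (max (2 : ℝ) ((l₀ * Real.exp l₀) ^ 2)) (max (2 * Real.exp l₀) (4 / l₀))) (max (l₀ / 2) (1 / ε₀)))
  have h2 : (2 : ℝ) < n := lt_of_le_of_lt (le_trans (le_max_left _ _) (le_trans (le_max_left _ _) (le_max_left _ _))) hn
  have hna : (l₀ * Real.exp l₀) ^ 2 < n :=
    lt_of_le_of_lt (le_trans (le_max_right _ _) (le_trans (le_max_left _ _) (le_max_left _ _))) hn
  have hne : 2 * Real.exp l₀ < n :=
    lt_of_le_of_lt (le_trans (le_max_left _ _) (le_trans (le_max_right _ _) (le_max_left _ _))) hn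
  have hnl : 4 / l₀ < n :=
    lt_of_le_of_lt (le_trans (le_max_right _ _) (le_trans (le_max_right _ _) (le_max_left _ _))) hn
  have hln : l₀ / 2 < n := lt_of_le_of_lt (le_trans (le_max_left _ _) (le_max_right _ _)) hn
  have hε₀n : 1 / ε₀ < n := lt_of_le_of_lt (le_trans (le_max_right _ _) (le_max_right _ _)) hn
  have hnr : (0 : ℝ) < n := by linarith
  have hn0 : 0 < n := by exact_mod_cast hnr
  have hn2 : 2 ≤ n := by exact_mod_cast h2.le
  obtain ⟨μ, ν, iμ, iν, hμ, hν, ε, hε, -, hε1, hcgf, -, -, htest, hrate⟩ :=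
    exists_cgf_close_laws_far_rate hl₀ hn2 hna.le hne.le hnl.le (by linarith)
  refine ⟨μ, ν, iμ, iν, hμ, hν, ε, hε, ?_, hcgf, fun x => (1 - cos (π * n * x)) / (π * n),
    lipschitzWith_one_cosWave hn0, fun x => ⟨cosWave_nonneg n x, (cosWave_le n x).trans ?_⟩, hrate⟩
  · -- `ε ≤ 1/n ≤ ε₀`
    refine hε1.trans ?_
    rw [div_le_iff₀ hnr]
    have := (div_lt_iff₀ hε₀).1 hε₀n
    linarith
  · -- `2∕(πn) ≤ 1`
    rw [div_le_one (by positivity)]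
    nlinarith [Real.pi_gt_three]

end Summit.QuantumFields.YangMills.Theorems.BalabanUVNodesN19LawPriceLowerRate

end
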